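import Mathlib
import Summits.Ventures.PercRepro2.HCov
import Summits.Ventures.PercRepro2.EdgeCubic
import Summits.Ventures.PercRepro2.EdgeCubicAll
import Summits.Ventures.PercRepro2.CPolarA3
import Summits.Ventures.PercRepro2.CPolarA3Marks
import Summits.Ventures.PercRepro2.PendantClusterPins
import Summits.Ventures.PercRepro2.PendantClusterBern
import Summits.Ventures.PercRepro2.CPolarA3Exists
import Summits.Ventures.PercRepro2.ClusterRootPins
import Summits.Ventures.PercRepro2.ClusterRootBern
import Summits.Ventures.PercRepro2.EdgeReloc

/-!
# A REACH-ROOT EDGE: an edge joining the pinned-open reach of `a₃` to the pinned-open reach of a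
root is, almost surely, the cluster-root edge `{r, z}` — so it is free in the induction
(blind cell PercRepro2, p5 g16; `proofs/P5-OEDGE.md` §19)

Let `e = {u, z}` with `z ∈ pinnedReach p ends a₃` and `u ∈ pinnedReach p ends r`, `r` a root
(`e` fractional). By EdgeReloc.lean, relocating the end `u` of `e` to `r` changes no pattern mass,
(HCOV) or Bernstein coefficient, and for the relocated edge map `e` is a cluster-root edge of
ClusterRootBern.lean; hence **`bern_nonneg_of_isReachRootEdge`**: `0 ≤ B1 ∧ 0 ≤ B2` at every
fractional reach-root edge given (HCOV) at `p[e↦0]`. The induction of `HCov_of_bern_a3_exists'`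
re-run with `GoodEdge''` gives **`HCov_all_of_cpolarA3ExistsRR_all`** — the crux from one good
`a₃`-edge per mark-free instance, where «root edge» is now read after contracting the weight-`1`
edges at BOTH ends (the `D_u = 0` pendant case of `proofs/P5-OEDGE.md` §16 — `u` almost surely in
the union cluster — is the special case `u ∈ pinnedReach p ends a₁ ∪ pinnedReach p ends a₂` of a
pendant `a₃`-cluster).
-/

namespace Summit.Ventures.PercRepro2

open UnionCluster CovForm CovForm.CPolarA3 PendantCluster CPolarA3Exists ClusterRoot EdgeReloc

namespace ReachRoot

/-! ## Row 2′CPOLAR at a reach-root edge -/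

section ReachRoot

variable {V : Type*} {E : Type*} [Fintype V] [DecidableEq V] [Fintype E] [DecidableEq E]
  {R : Type*} [Field R] [LinearOrder R] [IsStrictOrderedRing R]

open EdgeLine

/-- `e` is a ROOT EDGE OF THE FULLY CONTRACTED GRAPH: it joins the pinned-open reach of `a₃` to
the pinned-open reach of a root. -/
def IsReachRootEdge (p : E → R) (ends : E → Sym2 V) (a₁ a₂ a₃ : V) (e : E) : Prop :=
  ∃ z ∈ pinnedReach p ends a₃, ∃ u, (u ∈ pinnedReach p ends a₁ ∨ u ∈ pinnedReach p ends a₂) ∧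
    (ends e = s(u, z) ∨ ends e = s(z, u))

omit [Fintype V] [DecidableEq V] [Fintype E] [DecidableEq E] [IsStrictOrderedRing R] in
/-- A cluster-root edge is a reach-root edge (a root lies in its own reach). -/
lemma isReachRootEdge_of_isClusterRootEdge (p : E → R) (ends : E → Sym2 V) (a₁ a₂ a₃ : V) (e : E)
    (h : IsClusterRootEdge p ends a₁ a₂ a₃ e) : IsReachRootEdge p ends a₁ a₂ a₃ e := by
  obtain ⟨z, hz, h | h | h | h⟩ := h
  · exact ⟨z, hz, a₁, Or.inl self_mem_pinnedReach, Or.inl h⟩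
  · exact ⟨z, hz, a₁, Or.inl self_mem_pinnedReach, Or.inr h⟩
  · exact ⟨z, hz, a₂, Or.inr self_mem_pinnedReach, Or.inl h⟩
  · exact ⟨z, hz, a₂, Or.inr self_mem_pinnedReach, Or.inr h⟩

/-- **`0 ≤ B1` and `0 ≤ B2` at the edge `{u, z}` with `z` in the reach of `a₃` and `u` in the reach
of the root `r`** (given (HCOV) at `p[e↦0]` for `B1`): relocate `u` to `r`, where the edge is a
cluster-root edge. -/
theorem bern_nonneg_reach_root (p : E → R) (hp : IsProbVec p) (ends : E → Sym2 V)
    (o a₁ a₂ a₃ b r u z : V) (e : E) (hr : r = a₁ ∨ r = a₂) (hu : u ∈ pinnedReach p ends r)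
    (hz : z ∈ pinnedReach p ends a₃) (he : ends e = s(u, z)) (hf1 : p e ≠ 1)
    (h₀ : HCov (Function.update p e 0) ends o a₁ a₂ a₃ b) :
    0 ≤ B1 p ends o a₁ a₂ a₃ b e ∧ 0 ≤ B2 p ends o a₁ a₂ a₃ b e := by
  set ends' := Function.update ends e s(r, z) with hends'
  have hH₀ : ∀ ω, weight (Function.update p e 0) ω ≠ 0 →
      ∀ x y, Conn ends ω x y ↔ Conn ends' ω x y :=
    fun ω hw x y => conn_reloc_iff_ae (update_agree_off p e 0) hf1 hu he hw x y
  have hH₁ : ∀ ω, weight (Function.update p e 1) ω ≠ 0 →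
      ∀ x y, Conn ends ω x y ↔ Conn ends' ω x y :=
    fun ω hw x y => conn_reloc_iff_ae (update_agree_off p e 1) hf1 hu he hw x y
  have hz' : z ∈ pinnedReach p ends' a₃ := by rw [hends', pinnedReach_reloc p hf1]; exact hz
  have hcr : IsClusterRootEdge p ends' a₁ a₂ a₃ e := by
    refine ⟨z, hz', ?_⟩
    rcases hr with rfl | rfl
    · exact Or.inl (Function.update_self e _ ends)
    · exact Or.inr (Or.inr (Or.inl (Function.update_self e _ ends)))
  have h₀' : HCov (Function.update p e 0) ends' o a₁ a₂ a₃ b := (HCov_congr hH₀ o a₁ a₂ a₃ b).1 h₀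
  rw [B1_congr hH₀ hH₁, B2_congr hH₀ hH₁]
  exact ⟨B1_nonneg_of_isClusterRootEdge p hp ends' o a₁ a₂ a₃ b e hcr hf1 h₀',
    B2_nonneg_of_isClusterRootEdge p hp ends' o a₁ a₂ a₃ b e hcr⟩

/-- **`0 ≤ B1 ∧ 0 ≤ B2` at every fractional reach-root edge**, given (HCOV) at `p[e↦0]`. -/
theorem bern_nonneg_of_isReachRootEdge (p : E → R) (hp : IsProbVec p) (ends : E → Sym2 V)
    (o a₁ a₂ a₃ b : V) (e : E) (he : IsReachRootEdge p ends a₁ a₂ a₃ e) (hf1 : p e ≠ 1)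
    (h₀ : HCov (Function.update p e 0) ends o a₁ a₂ a₃ b) :
    0 ≤ B1 p ends o a₁ a₂ a₃ b e ∧ 0 ≤ B2 p ends o a₁ a₂ a₃ b e := by
  obtain ⟨z, hz, u, hu, hends | hends⟩ := he
  · rcases hu with hu | hu
    · exact bern_nonneg_reach_root p hp ends o a₁ a₂ a₃ b a₁ u z e (Or.inl rfl) hu hz hends hf1 h₀
    · exact bern_nonneg_reach_root p hp ends o a₁ a₂ a₃ b a₂ u z e (Or.inr rfl) hu hz hends hf1 h₀
  · have hends' : ends e = s(u, z) := by rw [hends, Sym2.eq_swap]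
    rcases hu with hu | hu
    · exact bern_nonneg_reach_root p hp ends o a₁ a₂ a₃ b a₁ u z e (Or.inl rfl) hu hz hends' hf1 h₀
    · exact bern_nonneg_reach_root p hp ends o a₁ a₂ a₃ b a₂ u z e (Or.inr rfl) hu hz hends' hf1 h₀

/-- An edge the induction can take: a reach-root edge, a pendant-PA edge, or an edge whose two
Bernstein coefficients are nonnegative. -/
def GoodEdge'' (q : E → R) (ends : E → Sym2 V) (o a₁ a₂ a₃ b : V) (e : E) : Prop :=
  IsReachRootEdge q ends a₁ a₂ a₃ e ∨ PendantPA q ends o a₁ a₂ a₃ e ∨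
    (0 ≤ B1 q ends o a₁ a₂ a₃ b e ∧ 0 ≤ B2 q ends o a₁ a₂ a₃ b e)

omit [Fintype V] [DecidableEq V] [IsStrictOrderedRing R] in
/-- `GoodEdge'` implies `GoodEdge''`. -/
lemma goodEdge''_of_goodEdge' (q : E → R) (ends : E → Sym2 V) (o a₁ a₂ a₃ b : V) (e : E)
    (h : GoodEdge' q ends o a₁ a₂ a₃ b e) : GoodEdge'' q ends o a₁ a₂ a₃ b e := by
  rcases h with h | h
  · exact Or.inl (isReachRootEdge_of_isClusterRootEdge q ends a₁ a₂ a₃ e h)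
  · exact Or.inr h

/-- **(HCOV) when every mark-free admissible weight vector with a fractional edge touching the reach
of `a₃` has a good fractional edge touching the reach** (reach-root edges included). -/
theorem HCov_of_bern_a3_exists'' (ends : E → Sym2 V) (o a₁ a₂ a₃ b : V)
    (hB : ∀ q : E → R, IsProbVec q → MarkFree q ends o a₁ a₂ a₃ b →
      (∃ e ∈ fracEdges q, TouchesReach q ends a₃ e) →
      ∃ e ∈ fracEdges q, TouchesReach q ends a₃ e ∧ GoodEdge'' q ends o a₁ a₂ a₃ b e)
    (p : E → R) (hp : IsProbVec p) : HCov p ends o a₁ a₂ a₃ b := by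
  generalize hn : (fracEdges p).card = n
  induction n using Nat.strong_induction_on generalizing p with
  | _ n ih =>
    by_cases hm : a₁ ∈ pinnedReach p ends a₃ ∨ a₂ ∈ pinnedReach p ends a₃ ∨
        o ∈ pinnedReach p ends a₃ ∨ b ∈ pinnedReach p ends a₃
    · exact HCov_of_mark_mem_pinnedReach hp hm
    · have hfree : MarkFree p ends o a₁ a₂ a₃ b := by
        simp only [not_or] at hm
        exact ⟨hm.1, hm.2.1, hm.2.2.1, hm.2.2.2⟩
      by_cases h : ∃ e ∈ fracEdges p, TouchesReach p ends a₃ e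
      · obtain ⟨e, he, _, hgood⟩ := hB p hp hfree h
        have hlt : ((fracEdges p).erase e).card < n := by
          rw [← hn]; exact Finset.card_erase_lt_of_mem he
        have hp₀ : IsProbVec (Function.update p e 0) := hp.update e le_rfl zero_le_one
        have hp₁ : IsProbVec (Function.update p e 1) := hp.update e zero_le_one le_rfl
        have h₀ : HCov (Function.update p e 0) ends o a₁ a₂ a₃ b :=
          ih _ hlt (Function.update p e 0) hp₀ (by rw [fracEdges_update p e 0 (Or.inl rfl)])
        have h₁ : HCov (Function.update p e 1) ends o a₁ a₂ a₃ b :=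
          ih _ hlt (Function.update p e 1) hp₁ (by rw [fracEdges_update p e 1 (Or.inr rfl)])
        have hfe : p e ≠ 0 ∧ p e ≠ 1 := by simpa [fracEdges] using he
        rcases hgood with hr | hpa | ⟨hB1, hB2⟩
        · obtain ⟨hB1, hB2⟩ := bern_nonneg_of_isReachRootEdge p hp ends o a₁ a₂ a₃ b e hr hfe.2 h₀
          exact HCov_of_update_zero_of_bern p hp ends o a₁ a₂ a₃ b e h₀ h₁ hB1 hB2
        · obtain ⟨hK, z, u, hends, hz, hu, hD, hcov⟩ := hpa
          exact HCov_cluster_of_cov_nonneg p hp hK hends hz hu hfe.2 hfree.1 hfree.2.1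
            hfree.2.2.1 hfree.2.2.2 hD h₀ h₁ hcov
        · exact HCov_of_update_zero_of_bern p hp ends o a₁ a₂ a₃ b e h₀ h₁ hB1 hB2
      · simp only [not_exists, not_and] at h
        exact HCov_of_reach_pinned p hp ends o a₁ a₂ a₃ b h

end ReachRoot

section Closure

variable (R : Type*) [Field R] [LinearOrder R] [IsStrictOrderedRing R]

/-- **One good `a₃`-edge per instance, reach-root edges included.** -/
def CPolarA3ExistsRR_all : Prop :=
  ∀ (V E : Type) [Fintype V] [DecidableEq V] [Fintype E] [DecidableEq E]
    (ends : E → Sym2 V) (p : E → R), IsProbVec p →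
    ∀ o a₁ a₂ a₃ b : V, a₁ ≠ a₂ → a₁ ≠ a₃ → a₂ ≠ a₃ → o ≠ a₁ → o ≠ a₂ → o ≠ a₃ → o ≠ b →
      b ≠ a₁ → b ≠ a₂ → b ≠ a₃ → MarkFree p ends o a₁ a₂ a₃ b →
      (∃ e ∈ fracEdges p, TouchesReach p ends a₃ e) →
      ∃ e ∈ fracEdges p, TouchesReach p ends a₃ e ∧ GoodEdge'' p ends o a₁ a₂ a₃ b e

omit [IsStrictOrderedRing R] in
/-- `CPolarA3ExistsRR_all` is weaker than `CPolarA3ExistsCR_all`. -/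
theorem cpolarA3ExistsRR_all_of_cpolarA3ExistsCR_all (h : CPolarA3ExistsCR_all R) :
    CPolarA3ExistsRR_all R := by
  intro V E _ _ _ _ ends p hp o a₁ a₂ a₃ b h1 h2 h3 h4 h5 h6 h7 h8 h9 h10 hfree hex
  obtain ⟨e, he, ht, hg⟩ := h V E ends p hp o a₁ a₂ a₃ b h1 h2 h3 h4 h5 h6 h7 h8 h9 h10 hfree hex
  exact ⟨e, he, ht, goodEdge''_of_goodEdge' p ends o a₁ a₂ a₃ b e hg⟩

/-- **One good `a₃`-edge per instance (reach-root edges included) implies the crux.** -/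
theorem HCov_all_of_cpolarA3ExistsRR_all (h : CPolarA3ExistsRR_all R) : HCov_all R := by
  intro V E _ _ _ _ ends p hp o a₁ a₂ a₃ b h1 h2 h3 h4 h5 h6 h7 h8 h9 h10
  exact HCov_of_bern_a3_exists'' ends o a₁ a₂ a₃ b
    (fun q hq hfree hex => h V E ends q hq o a₁ a₂ a₃ b h1 h2 h3 h4 h5 h6 h7 h8 h9 h10 hfree hex)
    p hp

end Closure

end ReachRoot

end Summit.Ventures.PercRepro2
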